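import Literature.InformationTheory.QuantumCodes.WeightEnumeratorBounds
import HarnessLib

/-!
# LP-infeasibility certificates for the Calderbank–Rains–Shor–Sloane linear program (Farkas form)

Venture QEC (cell `qec`, LADDER-QEC rung X1 «LP/shadow upper bounds per (n,k) — make "optimal" precise»; PARTITION
v2 row 06 follow-through). `Literature/InformationTheory/QuantumCodes/WeightEnumeratorBounds.lean` types the linear
system (16)–(21) of [CalderbankEtAl1998, Thm. 21] as `CRSSLPFeasible n k d` and the theorem «an `[[n,k,d]]` additive
code without weight-1 stabilizer elements makes it feasible» as the NAMED FACT `CRSS1998_theorem21_LP` (unproved in the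
tree). This file is OUR side: a checkable CERTIFICATE that the system is INfeasible, so that a census comparison cell
can print «no `[[n,k,d]]` (LP; conditional on CRSS98 Thm. 21; certificate `<id>`, tier KERNEL)» — the sense in which a
row is «LP-optimal for `(n,k)`» (lit-4 register B3: «rational LP with a dual certificate (Farkas vector) is
kernel-checkable»). Exactly the pattern of the tree's classical `Coding.card_le_delsarteBound` (MacWilliams–Sloane
Ch. 17 Thm. 20: any dual-feasible vector is a checkable bound), written for CRSS's system.

HONEST FRAMING: nothing here proves the LP bound. `not_crssLPFeasible_of_check` is UNCONDITIONAL (pure weak duality: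
a certificate refutes feasibility of the typed system); `no_additiveCode_of_check` is CONDITIONAL on the named fact
`CRSS1998_theorem21_LP` (its trust base is that name, D-0014) and inherits its hypothesis «no vector of weight 1 in the
stabilizer» (CRSS: «In view of Theorem 6(e), we may assume `A_1 = 0`» — a code whose stabilizer has a weight-1 element
lives on `n−1` qubits). Certificates are exact rationals; `CRSSCert.check` is a pure Boolean function (`decide` on `ℚ`),
so an instance `theorem … : CRSSCert.check c k d b = true := by decide` is tier KERNEL (or `native_decide`, tier
COMPILED, to be declared per CERT-FORMAT if ever used).

The certificate (one per branch `b` of the parity disjunction (20): `b = true` ↔ `2·Σ_{j even} A_j = 2^{n−k}`,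
`b = false` ↔ `Σ_{j even} A_j = 2^{n−k}`): multipliers `u0` (of `A_0 = 1`), `u1` (of `A_1 = 0`), `mu` (of (17)),
`w` (of the branch equation), `y_j` (of (19) written as `Σ_r P_j(r,n) A_r − 2^{n−k} A_j`, `= 0` for `j < d`, `≥ 0` for
`j ≥ d` — so `y_j ≥ 0` is required only for `j ≥ d`), `s_j ≥ 0` (of (21) written as
`2 Σ_{r even} P_j(r,n) A_r − Σ_r P_j(r,n) A_r ≥ 0`). Validity: the combined linear functional
`Σ_r κ_r A_r + κ_c` has `κ_r ≤ 0` for `0 ≤ r ≤ n` and `κ_c < 0`; then feasibility would give `0 ≤ … < 0`.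
A worked instance closes the file: `(n,k,d) = (7,1,4)` — both branches certified by `decide +kernel` (tier KERNEL),
so `¬ CRSSLPFeasible 7 1 4` unconditionally and «no `[[7,1,4]]`» conditionally on the fact, reproducing the CRSS
Table III entry `n = 7, k = 1: d = 3` (at `(7,1,3)` the system is feasible — the exact simplex finds no certificate —
consistent with the `[[7,1,3]]` codes). Certificates for other `(n,k,d)` (kernel cost measured: ≈ 1 s per branch at
`n = 16`) are produced by the exact-rational dual simplex `census/type-06/farkas.py` of the cell and land as DATA files
next to the census comparison tables, never here.

References: A. R. Calderbank, E. M. Rains, P. W. Shor, N. J. A. Sloane, IEEE Trans. Inform. Theory 44 (1998)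
1369–1387, §7 Thm. 21 and the implementation notes after Thm. 22 («If … no feasible solution exists, … we can conclude
that no `[[n,k,d]]` code exists»; exact arithmetic) [CalderbankEtAl1998]; F. J. MacWilliams, N. J. A. Sloane, *The
Theory of Error-Correcting Codes*, Ch. 17 §4 Thm. 20 (dual certificates) [MacWilliamsSloane1977].
-/

namespace Summit.Ventures.QEC.Census

open Finset Literature.InformationTheory.QuantumCodes

/-! ### One branch of CRSS's system -/

/-- Branch `b` of the CRSS system (16)–(21) for the unknowns `A_0..A_n` (`b = true`: `2 Σ_{j even} A_j = 2^{n−k}`,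
i.e. the even-weight subcode is half of `C`; `b = false`: `Σ_{j even} A_j = 2^{n−k}`, `C` even) — a PREDICATE on
`(n,k,d,b,A)` (definition, ours; the printed THEOREM is the named fact `CRSS1998_theorem21_LP`).
[cite: CalderbankEtAl1998, §7 Thm. 21 eqs. (16)–(21)] -/
def CRSSBranchFeasible (n k d : ℕ) (b : Bool) (A : ℕ → ℝ) : Prop :=
  A 0 = 1 ∧ A 1 = 0 ∧ (∀ j, j ≤ n → 0 ≤ A j) ∧
  ∑ j ∈ range (n + 1), A j = 2 ^ (n - k) ∧
  (∀ j, j + 1 ≤ d → A j = crssDual n k A j) ∧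
  (∀ j, d ≤ j → j ≤ n → A j ≤ crssDual n k A j) ∧
  (if b then 2 * ∑ j ∈ (range (n + 1)).filter Even, A j = 2 ^ (n - k)
    else ∑ j ∈ (range (n + 1)).filter Even, A j = 2 ^ (n - k)) ∧
  (∀ j, j ≤ n →
    2 ^ (n - k) * crssDual n k A j ≤ 2 * ∑ r ∈ (range (n + 1)).filter Even, (krawtchouk4 n j r : ℝ) * A r)

/-- `CRSSLPFeasible` is the disjunction of its two parity branches. [cite: CalderbankEtAl1998, §7 Thm. 21 eq. (20)] -/
theorem crssLPFeasible_iff (n k d : ℕ) :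
    CRSSLPFeasible n k d ↔ ∃ A : ℕ → ℝ, CRSSBranchFeasible n k d true A ∨ CRSSBranchFeasible n k d false A := by
  constructor
  · rintro ⟨A, h0, h1, hpos, hsum, heq, hle, hpar, hsh⟩
    refine ⟨A, ?_⟩
    rcases hpar with hp | hp
    · exact Or.inl ⟨h0, h1, hpos, hsum, heq, hle, by simpa using hp, hsh⟩
    · exact Or.inr ⟨h0, h1, hpos, hsum, heq, hle, by simpa using hp, hsh⟩
  · rintro ⟨A, h | h⟩
    · obtain ⟨h0, h1, hpos, hsum, heq, hle, hp, hsh⟩ := h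
      exact ⟨A, h0, h1, hpos, hsum, heq, hle, Or.inl (by simpa using hp), hsh⟩
    · obtain ⟨h0, h1, hpos, hsum, heq, hle, hp, hsh⟩ := h
      exact ⟨A, h0, h1, hpos, hsum, heq, hle, Or.inr (by simpa using hp), hsh⟩

/-! ### Certificates -/

/-- A Farkas-type **infeasibility certificate** for one parity branch of CRSS's system at length `n`: rational
multipliers `u0` (of `A_0 = 1`), `u1` (of `A_1 = 0`), `mu` (of `Σ_j A_j = 2^{n−k}`), `w` (of the branch equation),
`y = [y_0,…,y_n]` (of `Σ_r P_j(r,n) A_r − 2^{n−k} A_j`, which is `= 0` for `j < d` and `≥ 0` for `j ≥ d`),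
`s = [s_0,…,s_n]` (of `2 Σ_{r even} P_j(r,n) A_r − Σ_r P_j(r,n) A_r ≥ 0`); missing list entries read as `0`.
Column: definition (ours). [cite: MacWilliamsSloane1977, Ch. 17 §4 Thm. 20 (dual-feasible vectors as certificates)] -/
structure CRSSCert where
  /-- multiplier of `A_0 = 1` -/
  u0 : ℚ
  /-- multiplier of `A_1 = 0` -/
  u1 : ℚ
  /-- multiplier of `Σ_j A_j = 2^{n−k}` -/
  mu : ℚ
  /-- multiplier of the parity-branch equation -/
  w : ℚ
  /-- multipliers of the MacWilliams constraints (19) -/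
  y : List ℚ
  /-- multipliers of the shadow constraints (21) -/
  s : List ℚ

namespace CRSSCert

/-- `y_j` (zero beyond the list). [cite: MacWilliamsSloane1977, Ch. 17 §4 Thm. 20] -/
def yAt (c : CRSSCert) (j : ℕ) : ℚ := c.y.getD j 0

/-- `s_j` (zero beyond the list). [cite: MacWilliamsSloane1977, Ch. 17 §4 Thm. 20] -/
def sAt (c : CRSSCert) (j : ℕ) : ℚ := c.s.getD j 0

/-- The coefficient of `A_r` in the branch equation: `2·[r even]` (branch `true`) or `[r even]` (branch `false`).
[cite: CalderbankEtAl1998, §7 Thm. 21 eq. (20)] -/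
def parityCoeff (b : Bool) (r : ℕ) : ℚ := if Even r then (if b then 2 else 1) else 0

/-- The coefficient `κ_r` of `A_r` in the combined functional of the certificate. Column: definition (ours).
[cite: MacWilliamsSloane1977, Ch. 17 §4 Thm. 20] -/
def kappa (c : CRSSCert) (n k : ℕ) (b : Bool) (r : ℕ) : ℚ :=
  (if r = 0 then c.u0 else 0) + (if r = 1 then c.u1 else 0) + c.mu + c.w * parityCoeff b r +
    ∑ j ∈ range (n + 1), c.yAt j * ((krawtchouk4 n j r : ℚ) - if j = r then 2 ^ (n - k) else 0) +
    ∑ j ∈ range (n + 1), c.sAt j * (((if Even r then 2 else 0) - 1) * (krawtchouk4 n j r : ℚ))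

/-- The constant term `κ_c` of the combined functional. Column: definition (ours).
[cite: MacWilliamsSloane1977, Ch. 17 §4 Thm. 20] -/
def kappaConst (c : CRSSCert) (n k : ℕ) : ℚ :=
  -c.u0 - c.mu * 2 ^ (n - k) - c.w * 2 ^ (n - k)

/-- **The certificate checker** (pure, `decide`-able): sign conditions `y_j ≥ 0` for `d ≤ j ≤ n`, `s_j ≥ 0`,
`κ_r ≤ 0` for `0 ≤ r ≤ n`, and `κ_c < 0`. Column: definition (ours).
[cite: MacWilliamsSloane1977, Ch. 17 §4 Thm. 20] -/
def check (c : CRSSCert) (n k d : ℕ) (b : Bool) : Bool :=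
  ((List.range (n + 1)).all fun j => !(decide (d ≤ j)) || decide (0 ≤ c.yAt j)) &&
  ((List.range (n + 1)).all fun j => decide (0 ≤ c.sAt j)) &&
  ((List.range (n + 1)).all fun r => decide (c.kappa n k b r ≤ 0)) &&
  decide (c.kappaConst n k < 0)

/-- Unpacking a successful check. [cite: MacWilliamsSloane1977, Ch. 17 §4 Thm. 20] -/
theorem check_spec {c : CRSSCert} {n k d : ℕ} {b : Bool} (h : c.check n k d b = true) :
    (∀ j ∈ range (n + 1), d ≤ j → 0 ≤ c.yAt j) ∧ (∀ j ∈ range (n + 1), 0 ≤ c.sAt j) ∧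
    (∀ r ∈ range (n + 1), c.kappa n k b r ≤ 0) ∧ c.kappaConst n k < 0 := by
  simp only [check, Bool.and_eq_true, List.all_eq_true, Bool.or_eq_true, Bool.not_eq_true',
    decide_eq_false_iff_not, decide_eq_true_eq, List.mem_range] at h
  obtain ⟨⟨⟨hy, hs⟩, hk⟩, hc⟩ := h
  refine ⟨fun j hj hdj => ?_, fun j hj => hs j (by simpa using hj), fun r hr => hk r (by simpa using hr), hc⟩
  rcases hy j (by simpa using hj) with h' | h'
  · exact absurd hdj h'
  · exact h'

end CRSSCert

/-! ### Weak duality -/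

section Soundness

variable {n k d : ℕ}

/-- `2^{n−k} A′_j = Σ_r P_j(r,n) A_r`. [cite: CalderbankEtAl1998, §7 Thm. 21 eq. (18)] -/
theorem two_pow_mul_crssDual (A : ℕ → ℝ) (j : ℕ) :
    (2 : ℝ) ^ (n - k) * crssDual n k A j = ∑ r ∈ range (n + 1), (krawtchouk4 n j r : ℝ) * A r := by
  unfold crssDual
  rw [← mul_assoc, mul_one_div_cancel (pow_ne_zero _ two_ne_zero), one_mul]

/-- **The combined functional, expanded**: for every real vector `A`,
`Σ_{r ≤ n} κ_r A_r + κ_c = u0 (A_0 − 1) + u1·(Σ_r [r=1] A_r) + mu (Σ_r A_r − 2^{n−k}) + w (Σ_r c_b(r) A_r − 2^{n−k})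
 + Σ_j y_j (Σ_r P_j(r) A_r − 2^{n−k} A_j) + Σ_j s_j (2 Σ_{r even} P_j(r) A_r − Σ_r P_j(r) A_r)`.
[cite: MacWilliamsSloane1977, Ch. 17 §4 Thm. 15 (weak duality computation)] -/
theorem sum_kappa_mul_add_kappaConst (c : CRSSCert) (b : Bool) (A : ℕ → ℝ) :
    ∑ r ∈ range (n + 1), (c.kappa n k b r : ℝ) * A r + (c.kappaConst n k : ℝ) =
      (c.u0 : ℝ) * (A 0 - 1) +
      (c.u1 : ℝ) * ∑ r ∈ range (n + 1), (if r = 1 then A r else 0) +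
      (c.mu : ℝ) * (∑ r ∈ range (n + 1), A r - 2 ^ (n - k)) +
      (c.w : ℝ) * (∑ r ∈ range (n + 1), (CRSSCert.parityCoeff b r : ℝ) * A r - 2 ^ (n - k)) +
      ∑ j ∈ range (n + 1), (c.yAt j : ℝ) *
        (∑ r ∈ range (n + 1), (krawtchouk4 n j r : ℝ) * A r - 2 ^ (n - k) * A j) +
      ∑ j ∈ range (n + 1), (c.sAt j : ℝ) *
        ∑ r ∈ range (n + 1), (((if Even r then 2 else 0) - 1) * (krawtchouk4 n j r : ℝ)) * A r := by
  -- push the casts inside `kappa`, `kappaConst`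
  have hk : ∀ r, (c.kappa n k b r : ℝ) =
      (if r = 0 then (c.u0 : ℝ) else 0) + (if r = 1 then (c.u1 : ℝ) else 0) + c.mu +
        c.w * (CRSSCert.parityCoeff b r : ℝ) +
        ∑ j ∈ range (n + 1), (c.yAt j : ℝ) * ((krawtchouk4 n j r : ℝ) - if j = r then 2 ^ (n - k) else 0) +
        ∑ j ∈ range (n + 1), (c.sAt j : ℝ) * (((if Even r then 2 else 0) - 1) * (krawtchouk4 n j r : ℝ)) := by
    intro r
    simp only [CRSSCert.kappa]
    push_cast
    congr 1
    · congr 1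
      · congr 1
        · congr 1
          all_goals split_ifs <;> simp
      · refine Finset.sum_congr rfl fun j _ => ?_
        split_ifs <;> simp
    · refine Finset.sum_congr rfl fun j _ => ?_
      split_ifs <;> push_cast <;> ring
  have hc : (c.kappaConst n k : ℝ) = -(c.u0 : ℝ) - c.mu * 2 ^ (n - k) - c.w * 2 ^ (n - k) := by
    simp only [CRSSCert.kappaConst]; push_cast; ring
  simp_rw [hk]
  rw [hc]
  have h0 : (0 : ℕ) ∈ range (n + 1) := by simp
  -- split the sum over r into its six summands
  simp only [add_mul, Finset.sum_add_distrib]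
  -- (i) the `u0` term
  have e0 : ∑ r ∈ range (n + 1), (if r = 0 then (c.u0 : ℝ) else 0) * A r = (c.u0 : ℝ) * A 0 := by
    rw [Finset.sum_eq_single_of_mem 0 h0]
    · simp
    · intro r _ hr; simp [hr]
  -- (ii) the `u1` term
  have e1 : ∑ r ∈ range (n + 1), (if r = 1 then (c.u1 : ℝ) else 0) * A r =
      (c.u1 : ℝ) * ∑ r ∈ range (n + 1), (if r = 1 then A r else 0) := by
    rw [Finset.mul_sum]
    refine Finset.sum_congr rfl fun r _ => ?_
    split_ifs <;> simp
  -- (iii) `mu`, (iv) `w`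
  have e2 : ∑ r ∈ range (n + 1), (c.mu : ℝ) * A r = (c.mu : ℝ) * ∑ r ∈ range (n + 1), A r := by
    rw [Finset.mul_sum]
  have e3 : ∑ r ∈ range (n + 1), (c.w : ℝ) * (CRSSCert.parityCoeff b r : ℝ) * A r =
      (c.w : ℝ) * ∑ r ∈ range (n + 1), (CRSSCert.parityCoeff b r : ℝ) * A r := by
    rw [Finset.mul_sum]
    refine Finset.sum_congr rfl fun r _ => ?_
    ring
  -- (v) the `y` double sum
  have e4 : ∑ r ∈ range (n + 1),
      (∑ j ∈ range (n + 1), (c.yAt j : ℝ) * ((krawtchouk4 n j r : ℝ) - if j = r then 2 ^ (n - k) else 0)) * A r =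
      ∑ j ∈ range (n + 1), (c.yAt j : ℝ) *
        (∑ r ∈ range (n + 1), (krawtchouk4 n j r : ℝ) * A r - 2 ^ (n - k) * A j) := by
    simp only [Finset.sum_mul]
    rw [Finset.sum_comm]
    refine Finset.sum_congr rfl fun j hj => ?_
    have hδ : (2 : ℝ) ^ (n - k) * A j =
        ∑ x ∈ range (n + 1), (if j = x then (2 : ℝ) ^ (n - k) * A x else 0) := by
      rw [Finset.sum_ite_eq, if_pos hj]
    rw [mul_sub, Finset.mul_sum, hδ, Finset.mul_sum, ← Finset.sum_sub_distrib]
    refine Finset.sum_congr rfl fun x _ => ?_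
    split_ifs <;> ring
  -- (vi) the `s` double sum
  have e5 : ∑ r ∈ range (n + 1),
      (∑ j ∈ range (n + 1), (c.sAt j : ℝ) * (((if Even r then 2 else 0) - 1) * (krawtchouk4 n j r : ℝ))) * A r =
      ∑ j ∈ range (n + 1), (c.sAt j : ℝ) *
        ∑ r ∈ range (n + 1), (((if Even r then 2 else 0) - 1) * (krawtchouk4 n j r : ℝ)) * A r := by
    simp only [Finset.sum_mul]
    rw [Finset.sum_comm]
    refine Finset.sum_congr rfl fun j _ => ?_
    rw [Finset.mul_sum]
    refine Finset.sum_congr rfl fun r _ => ?_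
    ring
  rw [e0, e1, e2, e3, e4, e5]
  ring

/-- The parity sum written with an indicator. [cite: CalderbankEtAl1998, §7 Thm. 21 eq. (20)] -/
theorem sum_parityCoeff_mul (b : Bool) (A : ℕ → ℝ) :
    ∑ r ∈ range (n + 1), (CRSSCert.parityCoeff b r : ℝ) * A r =
      (if b then 2 else 1) * ∑ r ∈ (range (n + 1)).filter Even, A r := by
  rw [Finset.sum_filter, Finset.mul_sum]
  refine Finset.sum_congr rfl fun r _ => ?_
  unfold CRSSCert.parityCoeff
  split_ifs <;> push_cast <;> ring

/-- The shadow combination written with an indicator. [cite: CalderbankEtAl1998, §7 Thm. 21 eq. (21)] -/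
theorem sum_shadowCoeff_mul (A : ℕ → ℝ) (j : ℕ) :
    ∑ r ∈ range (n + 1), (((if Even r then 2 else 0) - 1) * (krawtchouk4 n j r : ℝ)) * A r =
      2 * ∑ r ∈ (range (n + 1)).filter Even, (krawtchouk4 n j r : ℝ) * A r -
        ∑ r ∈ range (n + 1), (krawtchouk4 n j r : ℝ) * A r := by
  rw [Finset.sum_filter, Finset.mul_sum, ← Finset.sum_sub_distrib]
  refine Finset.sum_congr rfl fun r _ => ?_
  split_ifs <;> ring

/-- **Weak duality**: a certificate that checks refutes its branch. Column: proved (ours).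
[cite: MacWilliamsSloane1977, Ch. 17 §4 Thm. 20 (dual-feasible ⇒ bound; here: ⇒ infeasible)] -/
theorem not_branchFeasible_of_check (c : CRSSCert) {b : Bool} (h : c.check n k d b = true) (A : ℕ → ℝ) :
    ¬ CRSSBranchFeasible n k d b A := by
  intro hA
  obtain ⟨hy, hs, hκ, hκc⟩ := CRSSCert.check_spec h
  obtain ⟨h0, h1, hpos, hsum, heq, hle, hpar, hsh⟩ := hA
  -- upper bound: Σ κ_r A_r + κ_c < 0
  have hub : ∑ r ∈ range (n + 1), (c.kappa n k b r : ℝ) * A r + (c.kappaConst n k : ℝ) < 0 := by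
    have h1' : ∑ r ∈ range (n + 1), (c.kappa n k b r : ℝ) * A r ≤ 0 :=
      Finset.sum_nonpos fun r hr =>
        mul_nonpos_of_nonpos_of_nonneg (by exact_mod_cast hκ r hr) (hpos r (by simpa using hr))
    have h2' : (c.kappaConst n k : ℝ) < 0 := by exact_mod_cast hκc
    linarith
  -- lower bound: the expansion is a sum of nonnegative terms
  have hlb : 0 ≤ ∑ r ∈ range (n + 1), (c.kappa n k b r : ℝ) * A r + (c.kappaConst n k : ℝ) := by
    rw [sum_kappa_mul_add_kappaConst]
    have t0 : (c.u0 : ℝ) * (A 0 - 1) = 0 := by rw [h0]; ring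
    have t1 : (c.u1 : ℝ) * ∑ r ∈ range (n + 1), (if r = 1 then A r else 0) = 0 := by
      rw [Finset.sum_eq_zero, mul_zero]
      intro r _
      split_ifs with hr
      · rw [hr, h1]
      · rfl
    have t2 : (c.mu : ℝ) * (∑ r ∈ range (n + 1), A r - 2 ^ (n - k)) = 0 := by rw [hsum]; ring
    have t3 : (c.w : ℝ) * (∑ r ∈ range (n + 1), (CRSSCert.parityCoeff b r : ℝ) * A r - 2 ^ (n - k)) = 0 := by
      rw [sum_parityCoeff_mul]
      cases b
      · simp only [Bool.false_eq_true, ↓reduceIte, one_mul] at hpar ⊢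
        rw [hpar]; ring
      · simp only [↓reduceIte] at hpar ⊢
        rw [hpar]; ring
    have t4 : 0 ≤ ∑ j ∈ range (n + 1), (c.yAt j : ℝ) *
        (∑ r ∈ range (n + 1), (krawtchouk4 n j r : ℝ) * A r - 2 ^ (n - k) * A j) := by
      refine Finset.sum_nonneg fun j hj => ?_
      have hjn : j ≤ n := by simpa [Nat.lt_succ_iff] using hj
      rw [← two_pow_mul_crssDual, ← mul_sub]
      rcases lt_or_ge j d with hjd | hjd
      · -- equality constraint: the bracket vanishes
        rw [← heq j hjd]; simp
      · exact mul_nonneg (by exact_mod_cast hy j hj hjd)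
          (mul_nonneg (pow_nonneg zero_le_two _) (sub_nonneg.mpr (hle j hjd hjn)))
    have t5 : 0 ≤ ∑ j ∈ range (n + 1), (c.sAt j : ℝ) *
        ∑ r ∈ range (n + 1), (((if Even r then 2 else 0) - 1) * (krawtchouk4 n j r : ℝ)) * A r := by
      refine Finset.sum_nonneg fun j hj => ?_
      have hjn : j ≤ n := by simpa [Nat.lt_succ_iff] using hj
      rw [sum_shadowCoeff_mul, ← two_pow_mul_crssDual]
      exact mul_nonneg (by exact_mod_cast hs j hj) (sub_nonneg.mpr (hsh j hjn))
    linarith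
  linarith

/-- **Two checked certificates (one per parity branch) refute CRSS's system** — UNCONDITIONAL. Column: proved (ours).
[cite: CalderbankEtAl1998, §7 (after Thm. 22: «if … no feasible solution exists … no [[n,k,d]] code exists»)] -/
theorem not_crssLPFeasible_of_check (c₁ c₂ : CRSSCert) (h₁ : c₁.check n k d true = true)
    (h₂ : c₂.check n k d false = true) : ¬ CRSSLPFeasible n k d := by
  rw [crssLPFeasible_iff]
  rintro ⟨A, hA | hA⟩
  · exact not_branchFeasible_of_check c₁ h₁ A hA
  · exact not_branchFeasible_of_check c₂ h₂ A hA

/-- **Certified LP upper bound, conditional on CRSS Theorem 21**: granted the named fact `CRSS1998_theorem21_LP`, two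
checked certificates show that no `[[n,k,d]]` additive code whose stabilizer has no weight-1 element exists (in the
tree's monotone reading: no such code with minimum distance `≥ d`). The trust base is the cited fact; the hypothesis
on weight-1 elements is the printed one («we may assume `A_1 = 0`», by CRSS Thm. 6(e) a code with a weight-1
stabilizer element descends to length `n − 1`). Column: proved (ours), CONDITIONAL.
[cite: CalderbankEtAl1998, §7 Thm. 21] -/
theorem no_additiveCode_of_check (hLP : CRSS1998_theorem21_LP) (c₁ c₂ : CRSSCert)
    (h₁ : c₁.check n k d true = true) (h₂ : c₂.check n k d false = true)
    (S : Submodule (ZMod 2) (SympVec n)) (hS : IsAdditiveCode S k d) (h1 : ∀ v ∈ S, sympWeight v ≠ 1) : False :=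
  not_crssLPFeasible_of_check c₁ c₂ h₁ h₂ (hLP n k d S hS h1)

end Soundness

/-! ### A worked instance: no `[[7,1,4]]` — CRSS Table III, `n = 7`, `k = 1`: `d = 3` (unmarked upper bound = Thm. 21) -/

/-- Certificate for branch `true` of the system at `(n,k,d) = (7,1,4)` (found by exact rational simplex on the dual
system; cell qec, `run/shared/lean/pub/qec/census/type-06/farkas.py`). Column: data (ours).
[cite: CalderbankEtAl1998, §8 Table III (n = 7, k = 1: d = 3, upper bound unmarked = Thm. 21)] -/
def cert_7_1_4_true : CRSSCert :=
  ⟨(41/3), 14, (-7/24), (3/32), [0, (-7/192), (-1/24), (-1/64), 0, 0, 0, 0], [0, 0, 0, (1/96), 0, 0, 0, 0]⟩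

/-- Certificate for branch `false` at `(7,1,4)`. Column: data (ours).
[cite: CalderbankEtAl1998, §8 Table III (n = 7, k = 1)] -/
def cert_7_1_4_false : CRSSCert :=
  ⟨(-34/21), (4/7), (-5/192), (15/224), [0, (-1/192), (1/2688), (-1/1344), 0, 0, (1/2688), 0], [0, 0, (1/448), 0, 0, 0, 0, 0]⟩

/-- Both certificates check (kernel evaluation, `decide +kernel`: tier KERNEL, no extra axioms).
[cite: CalderbankEtAl1998, §8 Table III (n = 7, k = 1)] -/
theorem check_cert_7_1_4 :
    cert_7_1_4_true.check 7 1 4 true = true ∧ cert_7_1_4_false.check 7 1 4 false = true := by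
  constructor <;> decide +kernel

/-- **CRSS's system (16)–(21) is infeasible at `(n,k,d) = (7,1,4)`** — unconditional, kernel-checked; this is the
tree-side reproduction of the Table III entry «`n = 7`, `k = 1`: `d = 3`» as an LP statement (the system IS feasible at
`(7,1,3)`: no certificate exists there, consistent with the `[[7,1,3]]` codes). Column: proved (ours).
[cite: CalderbankEtAl1998, §8 Table III (n = 7, k = 1) with §7 Thm. 21] -/
theorem not_crssLPFeasible_7_1_4 : ¬ CRSSLPFeasible 7 1 4 :=
  not_crssLPFeasible_of_check _ _ check_cert_7_1_4.1 check_cert_7_1_4.2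

/-- **No `[[7,1,4]]` additive code without weight-1 stabilizer elements — CONDITIONAL on CRSS Theorem 21** (the named
fact `CRSS1998_theorem21_LP`; trust base = that name). Column: proved (ours), conditional.
[cite: CalderbankEtAl1998, §8 Table III (n = 7, k = 1) with §7 Thm. 21] -/
theorem no_additiveCode_7_1_4 (hLP : CRSS1998_theorem21_LP) (S : Submodule (ZMod 2) (SympVec 7))
    (hS : IsAdditiveCode S 1 4) (h1 : ∀ v ∈ S, sympWeight v ≠ 1) : False :=
  no_additiveCode_of_check hLP _ _ check_cert_7_1_4.1 check_cert_7_1_4.2 S hS h1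

end Summit.Ventures.QEC.Census
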